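import Literature.NumberTheory.LFunctions.RosserSchoenfeldMertensFirst
import Mathlib.NumberTheory.Chebyshev
import Mathlib.Data.Nat.Choose.Factorization
import Mathlib.Analysis.SpecialFunctions.Stirling
import Mathlib.Analysis.Complex.ExponentialBounds
import HarnessLib

/-!
# Rosser–Schoenfeld 1962, (3.24): `Σ_{p ≤ x} (log p)/p < log x` for `x > 1` — proof

Literature/NumberTheory/LFunctions. This file DISCHARGES the named fact
`RosserSchoenfeld1962_eq_3_24` of `RosserSchoenfeldMertensFirst.lean`
(J. B. Rosser, L. Schoenfeld, *Approximate formulas for some functions of prime numbers*,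
Illinois J. Math. 6 (1962), 64–94, Corollary to Theorem 6, (3.24), p. 70):
for real `x > 1`, `Σ_{p ≤ x} (log p)/p < log x`.

## The proof (elementary; NOT the one printed)

Rosser–Schoenfeld obtain (3.24) from their sharp two-sided estimate (3.21)–(3.22)
(`Σ_{p ≤ x} (log p)/p = log x + E + O(1/log x)`, `E = −1.332…`), which rests on explicit bounds
for `θ(x)` from zero-free regions and Rosser's verification of the Riemann hypothesis for the
first zeros, plus their Table I for small `x`. Because the constant `E` leaves a margin of `1.33`,
the one-sided bound (3.24) by itself has a short *elementary* proof, which is what is formalized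
here (a deliberate deviation from the source; the statement proved is exactly the printed one):

* Legendre: `log N! = Σ_p v_p(N!) log p ≥ Σ_{p ≤ N} ⌊N/p⌋ log p`
  `+ (⌊N/4⌋+⌊N/8⌋+⌊N/16⌋+⌊N/32⌋) log 2 + (⌊N/9⌋+⌊N/27⌋) log 3`
  (Mathlib: `Nat.factorization_factorial`, `Real.log_nat_eq_sum_factorization`);
* `⌊N/m⌋ ≥ (N+1)/m − 1`, so `(N+1) Σ_{p ≤ N} (log p)/p ≤ Σ_{p ≤ N} ⌊N/p⌋ log p + θ(N)`;
* Chebyshev: `θ(N) ≤ N log 4` (Mathlib: `Chebyshev.theta_le_log4_mul_x`);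
* Stirling: `log N! ≤ N log N − N + (log N)/2 + 1` (Mathlib: `Stirling.log_stirlingSeq'_antitone`);
* hence `(N+1)(Σ_{p ≤ N} (log p)/p − log N) ≤ 1 − N + 2N log 2 − ((N+1)15/32 − 4) log 2`
  `− ((N+1)4/27 − 2) log 3 − (log N)/2 < 0` for `N ≥ 41` (`log 2 < 0.6931471808`, `2^19 ≤ 3^12`);
* `2 ≤ N ≤ 40`: twelve explicit checks `Σ_{p ≤ q} (log p)/p < log q` at the primes `q ≤ 37`,
  in units of `log 2` via `a^d ≤ b^c ⇒ d log a ≤ c log b` (e.g. `3^5 ≤ 2^8`, `5^3 ≤ 2^7`);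
* real `x > 1`: `N = ⌊x⌋ ≥ 1`; `N = 1` has an empty sum and `log x > 0`; else `log N ≤ log x`.

## References
* J. B. Rosser, L. Schoenfeld, Illinois J. Math. 6 (1962), 64–94, Thm. 6 and Cor. (3.24), p. 70
  (held: `lit read doi:10.1215/ijm/1255631807`, PDF p. 7). (key `RosserSchoenfeld1962`)
* G. H. Hardy, E. M. Wright, *An Introduction to the Theory of Numbers*, Thm. 424–425 (§22.6)
  (the elementary method). (key `HardyWright2008`)
-/

noncomputable section

namespace Literature.NumberTheory.LFunctions

namespace RosserSchoenfeld324

open Nat hiding log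
open Finset Real

/-! ### Small tools -/

/-- `(N+1)/m − 1 ≤ ⌊N/m⌋` (as reals), i.e. `N < (⌊N/m⌋ + 1) m`. [folklore] -/
theorem sub_one_le_natDiv (N m : ℕ) (hm : 0 < m) :
    ((N : ℝ) + 1) / m - 1 ≤ ((N / m : ℕ) : ℝ) := by
  have h1 : N + 1 ≤ N / m * m + m := Nat.lt_div_mul_add hm
  have hm' : (0 : ℝ) < m := by exact_mod_cast hm
  rw [sub_le_iff_le_add, div_le_iff₀ hm']
  calc (N : ℝ) + 1 = ((N + 1 : ℕ) : ℝ) := by push_cast; ring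
    _ ≤ ((N / m * m + m : ℕ) : ℝ) := by exact_mod_cast h1
    _ = (((N / m : ℕ) : ℝ) + 1) * m := by push_cast; ring

/-- `a^d ≤ b^c` gives `d log a ≤ c log b` for naturals `a > 0`, `b` (monotonicity of `log`);
used to compare logarithms of small primes with `log 2`. [folklore] -/
theorem pow_log_le (a d b c : ℕ) (ha : 0 < a := by norm_num) (h : a ^ d ≤ b ^ c := by norm_num) :
    (d : ℝ) * Real.log a ≤ c * Real.log b := by
  rw [← Real.log_pow, ← Real.log_pow]
  exact Real.log_le_log (by positivity) (by exact_mod_cast h)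

/-- Each term `(log p)/p` (`p : ℕ`) is nonnegative. [folklore] -/
theorem log_div_self_nonneg (p : ℕ) : 0 ≤ Real.log p / p :=
  div_nonneg (Real.log_natCast_nonneg p) (Nat.cast_nonneg p)

/-- `N ↦ Σ_{p ≤ N} (log p)/p` is non-decreasing. [folklore] -/
theorem sum_mono {N M : ℕ} (h : N ≤ M) :
    ∑ p ∈ primesLE N, Real.log p / p ≤ ∑ p ∈ primesLE M, Real.log p / p :=
  sum_le_sum_of_subset_of_nonneg (Nat.primesLE_mono h) fun p _ _ => log_div_self_nonneg p

/-- `Σ_{p ≤ N} (log p)/p ≤ Σ_{p ∈ t} (log p)/p` whenever `N ≤ M` and `{p ≤ M} ⊆ t`. [folklore] -/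
theorem sum_le_of_subset {N M : ℕ} {t : Finset ℕ} (hNM : N ≤ M) (ht : primesLE M ⊆ t) :
    ∑ p ∈ primesLE N, Real.log p / p ≤ ∑ p ∈ t, Real.log p / p :=
  (sum_mono hNM).trans (sum_le_sum_of_subset_of_nonneg ht fun p _ _ => log_div_self_nonneg p)

/-! ### Legendre -/

/-- Legendre's formula, truncated: `Σ_{1 ≤ i ≤ k} ⌊N/p^i⌋ ≤ v_p(N!)` for `k ≤ N`
(Mathlib's `Nat.factorization_factorial` is the exact formula). [folklore] -/
theorem sum_div_pow_le_factorization {p N k : ℕ} (hp : p.Prime) (hk : k ≤ N) :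
    ∑ i ∈ Ico 1 (k + 1), N / p ^ i ≤ (N)!.factorization p := by
  rw [Nat.factorization_factorial hp (b := N + 1) (Nat.lt_succ_of_le (Nat.log_le_self p N))]
  exact sum_le_sum_of_subset_of_nonneg (Ico_subset_Ico_right (by omega))
    (fun _ _ _ => Nat.zero_le _)

/-- `⌊N/p⌋ ≤ v_p(N!)`. [folklore] -/
theorem div_le_factorization {p : ℕ} (N : ℕ) (hp : p.Prime) :
    N / p ≤ (N)!.factorization p := by
  rcases Nat.eq_zero_or_pos N with rfl | hN
  · simp
  have h := sum_div_pow_le_factorization (N := N) (k := 1) hp hN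
  simpa using h

/-- `⌊N/2⌋ + ⌊N/4⌋ + ⌊N/8⌋ + ⌊N/16⌋ + ⌊N/32⌋ ≤ v_2(N!)` (`N ≥ 5`). [folklore] -/
theorem legendre_two (N : ℕ) (hN : 5 ≤ N) :
    N / 2 + N / 4 + N / 8 + N / 16 + N / 32 ≤ (N)!.factorization 2 := by
  have h := sum_div_pow_le_factorization (N := N) (k := 5) Nat.prime_two hN
  rw [Finset.sum_Ico_eq_sum_range] at h
  simp only [Finset.sum_range_succ, Finset.sum_range_zero] at h
  norm_num at h
  omega

/-- `⌊N/3⌋ + ⌊N/9⌋ + ⌊N/27⌋ ≤ v_3(N!)` (`N ≥ 3`). [folklore] -/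
theorem legendre_three (N : ℕ) (hN : 3 ≤ N) :
    N / 3 + N / 9 + N / 27 ≤ (N)!.factorization 3 := by
  have h := sum_div_pow_le_factorization (N := N) (k := 3) Nat.prime_three hN
  rw [Finset.sum_Ico_eq_sum_range] at h
  simp only [Finset.sum_range_succ, Finset.sum_range_zero] at h
  norm_num at h
  omega

/-- Legendre, keeping the prime-power terms at `2` and `3`:
`Σ_{p ≤ N} ⌊N/p⌋ log p + (⌊N/4⌋+⌊N/8⌋+⌊N/16⌋+⌊N/32⌋) log 2 + (⌊N/9⌋+⌊N/27⌋) log 3 ≤ log N!`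
for `N ≥ 5`. [cite: HardyWright2008, §22.6 (proof of Thm 424)] -/
theorem legendre_lower (N : ℕ) (hN : 5 ≤ N) :
    ∑ p ∈ primesLE N, ((N / p : ℕ) : ℝ) * Real.log p
      + ((N / 4 : ℕ) + (N / 8 : ℕ) + (N / 16 : ℕ) + (N / 32 : ℕ) : ℝ) * Real.log 2
      + ((N / 9 : ℕ) + (N / 27 : ℕ) : ℝ) * Real.log 3 ≤ Real.log (N)! := by
  -- `log N! = Σ_{p ∣ N!} v_p log p ≥ Σ_{p ≤ N} v_p log p`
  have hlogfact : ∑ p ∈ primesLE N, ((N)!.factorization p : ℝ) * Real.log p ≤ Real.log (N)! := by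
    rw [Real.log_nat_eq_sum_factorization (N)!, Finsupp.sum, Nat.support_factorization]
    have hsub : primesLE N ⊆ (N)!.primeFactors := by
      intro p hp
      rw [Nat.mem_primesLE] at hp
      exact Nat.mem_primeFactors.mpr ⟨hp.2, (Nat.Prime.dvd_factorial hp.2).mpr hp.1,
        Nat.factorial_ne_zero N⟩
    refine sum_le_sum_of_subset_of_nonneg hsub fun p hp _ => ?_
    exact mul_nonneg (Nat.cast_nonneg _)
      (Real.log_nonneg (by exact_mod_cast (Nat.prime_of_mem_primeFactors hp).one_lt.le))
  -- the excess `v_p - ⌊N/p⌋` is nonnegative termwise; at `2`, `3` it dominates the extra terms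
  have hnonneg : ∀ p ∈ primesLE N,
      0 ≤ (((N)!.factorization p : ℝ) - ((N / p : ℕ) : ℝ)) * Real.log p := by
    intro p hp
    have hpr := (Nat.mem_primesLE.mp hp).2
    refine mul_nonneg ?_ (Real.log_nonneg (by exact_mod_cast hpr.one_lt.le))
    have h := div_le_factorization N hpr
    have h' : ((N / p : ℕ) : ℝ) ≤ ((N)!.factorization p : ℝ) := by exact_mod_cast h
    linarith
  have hsplit : ∑ p ∈ primesLE N, ((N)!.factorization p : ℝ) * Real.log p =
      ∑ p ∈ primesLE N, ((N / p : ℕ) : ℝ) * Real.log p +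
        ∑ p ∈ primesLE N, (((N)!.factorization p : ℝ) - ((N / p : ℕ) : ℝ)) * Real.log p := by
    rw [← sum_add_distrib]
    exact sum_congr rfl fun p _ => by ring
  have h23 : ({2, 3} : Finset ℕ) ⊆ primesLE N := by
    intro p hp
    simp only [Finset.mem_insert, Finset.mem_singleton] at hp
    rcases hp with rfl | rfl
    · exact Nat.mem_primesLE.mpr ⟨by omega, Nat.prime_two⟩
    · exact Nat.mem_primesLE.mpr ⟨by omega, Nat.prime_three⟩
  have hpair : (((N)!.factorization 2 : ℝ) - ((N / 2 : ℕ) : ℝ)) * Real.log 2 +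
      (((N)!.factorization 3 : ℝ) - ((N / 3 : ℕ) : ℝ)) * Real.log 3 ≤
      ∑ p ∈ primesLE N, (((N)!.factorization p : ℝ) - ((N / p : ℕ) : ℝ)) * Real.log p := by
    have h := sum_le_sum_of_subset_of_nonneg h23 (f := fun p : ℕ =>
      (((N)!.factorization p : ℝ) - ((N / p : ℕ) : ℝ)) * Real.log p) fun p hp _ => hnonneg p hp
    rwa [Finset.sum_pair (by norm_num : (2 : ℕ) ≠ 3)] at h
  have h2 : ((N / 2 + N / 4 + N / 8 + N / 16 + N / 32 : ℕ) : ℝ) ≤ ((N)!.factorization 2 : ℝ) := by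
    exact_mod_cast legendre_two N hN
  have h3 : ((N / 3 + N / 9 + N / 27 : ℕ) : ℝ) ≤ ((N)!.factorization 3 : ℝ) := by
    exact_mod_cast legendre_three N (by omega)
  push_cast at h2 h3
  have hl2 : 0 ≤ Real.log 2 := Real.log_nonneg (by norm_num)
  have hl3 : 0 ≤ Real.log 3 := Real.log_nonneg (by norm_num)
  have hm2 : ((N / 4 : ℕ) + (N / 8 : ℕ) + (N / 16 : ℕ) + (N / 32 : ℕ) : ℝ) * Real.log 2 ≤
      (((N)!.factorization 2 : ℝ) - ((N / 2 : ℕ) : ℝ)) * Real.log 2 :=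
    mul_le_mul_of_nonneg_right (by linarith) hl2
  have hm3 : ((N / 9 : ℕ) + (N / 27 : ℕ) : ℝ) * Real.log 3 ≤
      (((N)!.factorization 3 : ℝ) - ((N / 3 : ℕ) : ℝ)) * Real.log 3 :=
    mul_le_mul_of_nonneg_right (by linarith) hl3
  linarith [hlogfact, hsplit, hpair, hm2, hm3]

/-! ### Stirling -/

/-- Stirling's upper bound `log N! ≤ N log N − N + (log N)/2 + 1` for `N ≥ 1`
(`stirlingSeq (n+1)` decreases from `stirlingSeq 1 = e/√2`). [folklore] -/
theorem log_factorial_le (N : ℕ) (hN : 1 ≤ N) :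
    Real.log (N)! ≤ N * Real.log N - N + Real.log N / 2 + 1 := by
  obtain ⟨n, rfl⟩ : ∃ n, N = n + 1 := ⟨N - 1, by omega⟩
  have hmono : Real.log (Stirling.stirlingSeq (n + 1)) ≤ Real.log (Stirling.stirlingSeq 1) := by
    have h := Stirling.log_stirlingSeq'_antitone (Nat.zero_le n)
    simpa only [Function.comp_apply, Nat.succ_eq_add_one, zero_add] using h
  have hc : Real.log (Stirling.stirlingSeq 1) = 1 - Real.log 2 / 2 := by
    rw [Stirling.stirlingSeq_one, Real.log_div (Real.exp_pos 1).ne' (by positivity), Real.log_exp,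
      Real.log_sqrt zero_le_two]
  have hN0 : (0 : ℝ) < ((n + 1 : ℕ) : ℝ) := by positivity
  have hf : Real.log (Stirling.stirlingSeq (n + 1)) = Real.log (n + 1)! -
      (Real.log 2 + Real.log ((n + 1 : ℕ) : ℝ)) / 2 -
      ((n + 1 : ℕ) : ℝ) * (Real.log ((n + 1 : ℕ) : ℝ) - 1) := by
    rw [Stirling.log_stirlingSeq_formula, Real.log_mul two_ne_zero hN0.ne',
      Real.log_div hN0.ne' (Real.exp_pos 1).ne', Real.log_exp]
    ring
  rw [hf, hc] at hmono
  linarith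

/-! ### The bound for `N ≥ 41` -/

/-- The elementary estimate: for `N ≥ 41`, `Σ_{p ≤ N} (log p)/p < log N`
(Legendre with the `2`- and `3`-power terms, `θ(N) ≤ N log 4`, Stirling,
`log 2 < 0.6931471808`, `2^19 ≤ 3^12`). [folklore] -/
theorem sum_lt_log_of_ge (N : ℕ) (hN : 41 ≤ N) :
    ∑ p ∈ primesLE N, Real.log p / p < Real.log N := by
  have hN0 : (0 : ℝ) < N := by exact_mod_cast (by omega : 0 < N)
  have hN41 : (41 : ℝ) ≤ N := by exact_mod_cast hN
  -- (1) `(N+1) S ≤ Σ ⌊N/p⌋ log p + θ(N)`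
  have hstep1 : ((N : ℝ) + 1) * ∑ p ∈ primesLE N, Real.log p / p ≤
      ∑ p ∈ primesLE N, ((N / p : ℕ) : ℝ) * Real.log p + ∑ p ∈ primesLE N, Real.log p := by
    rw [mul_sum, ← sum_add_distrib]
    refine sum_le_sum fun p hp => ?_
    have hpr := (Nat.mem_primesLE.mp hp).2
    have hp0 : (0 : ℝ) < p := by exact_mod_cast hpr.pos
    have hlog : 0 ≤ Real.log p := Real.log_nonneg (by exact_mod_cast hpr.one_lt.le)
    have hdiv := sub_one_le_natDiv N p hpr.pos
    calc ((N : ℝ) + 1) * (Real.log p / p) = (((N : ℝ) + 1) / p) * Real.log p := by ring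
      _ ≤ (((N / p : ℕ) : ℝ) + 1) * Real.log p := mul_le_mul_of_nonneg_right (by linarith) hlog
      _ = ((N / p : ℕ) : ℝ) * Real.log p + Real.log p := by ring
  -- (2) Chebyshev
  have hθ : ∑ p ∈ primesLE N, Real.log p ≤ Real.log 4 * N := by
    rw [← Chebyshev.theta_eq_sum_primesLE_log]
    exact Chebyshev.theta_le_log4_mul_x hN0.le
  have h4 : Real.log 4 = 2 * Real.log 2 := by
    rw [show (4 : ℝ) = 2 ^ 2 by norm_num, Real.log_pow]; norm_num
  rw [h4] at hθ
  -- (3) Legendre, (4) Stirling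
  have hleg := legendre_lower N (by omega)
  have hfact := log_factorial_le N (by omega)
  -- floors
  have e4 : ((N : ℝ) + 1) / 4 - 1 ≤ ((N / 4 : ℕ) : ℝ) := by
    exact_mod_cast sub_one_le_natDiv N 4 (by norm_num)
  have e8 : ((N : ℝ) + 1) / 8 - 1 ≤ ((N / 8 : ℕ) : ℝ) := by
    exact_mod_cast sub_one_le_natDiv N 8 (by norm_num)
  have e16 : ((N : ℝ) + 1) / 16 - 1 ≤ ((N / 16 : ℕ) : ℝ) := by
    exact_mod_cast sub_one_le_natDiv N 16 (by norm_num)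
  have e32 : ((N : ℝ) + 1) / 32 - 1 ≤ ((N / 32 : ℕ) : ℝ) := by
    exact_mod_cast sub_one_le_natDiv N 32 (by norm_num)
  have e9 : ((N : ℝ) + 1) / 9 - 1 ≤ ((N / 9 : ℕ) : ℝ) := by
    exact_mod_cast sub_one_le_natDiv N 9 (by norm_num)
  have e27 : ((N : ℝ) + 1) / 27 - 1 ≤ ((N / 27 : ℕ) : ℝ) := by
    exact_mod_cast sub_one_le_natDiv N 27 (by norm_num)
  -- numerics
  have hL := Real.log_two_lt_d9
  have hL0 := Real.log_two_gt_d9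
  have hM : (19 : ℝ) * Real.log 2 ≤ 12 * Real.log 3 := by
    exact_mod_cast pow_log_le 2 19 3 12
  have hlogN : (5 : ℝ) * Real.log 2 ≤ Real.log N := by
    have h : (5 : ℝ) * Real.log 2 ≤ 1 * Real.log N := by
      exact_mod_cast pow_log_le 2 5 N 1 (by norm_num) (by rw [pow_one]; norm_num; omega)
    linarith
  have hl2 : 0 ≤ Real.log 2 := by linarith
  have hl3 : 0 ≤ Real.log 3 := Real.log_nonneg (by norm_num)
  -- product facts for `linarith`
  have p1 : 0 ≤ (((N / 4 : ℕ) + (N / 8 : ℕ) + (N / 16 : ℕ) + (N / 32 : ℕ) : ℝ)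
      - (((N : ℝ) + 1) * (15 / 32) - 4)) * Real.log 2 :=
    mul_nonneg (by linarith) hl2
  have p2 : 0 ≤ (((N / 9 : ℕ) + (N / 27 : ℕ) : ℝ) - (((N : ℝ) + 1) * (4 / 27) - 2)) * Real.log 3 :=
    mul_nonneg (by linarith) hl3
  have p3 : 0 ≤ ((N : ℝ) - 41) * (1 - 49 / 32 * Real.log 2 + 4 / 27 * Real.log 3) :=
    mul_nonneg (by linarith) (by linarith)
  have key : ((N : ℝ) + 1) * ∑ p ∈ primesLE N, Real.log p / p < ((N : ℝ) + 1) * Real.log N := by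
    linarith [hstep1, hθ, hleg, hfact, p1, p2, p3, hM, hL, hL0, hlogN]
  exact lt_of_mul_lt_mul_left key (by positivity)

/-! ### The finite range `2 ≤ N ≤ 40` -/

/-- For `2 ≤ N ≤ 40`, `Σ_{p ≤ N} (log p)/p < log N`: twelve explicit checks at the primes
`q ≤ 37` in units of `log 2` (`3^5 ≤ 2^8`, `5^3 ≤ 2^7`, `7 ≤ 2^3`, `11^2 ≤ 2^7`, `13 ≤ 2^4`,
`17^2, 19^2 ≤ 2^9`, `23, 29, 31 ≤ 2^5`, `37 ≤ 2^6` from above; `2^3 ≤ 3^2`, `2^2 ≤ 5`,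
`2^5 ≤ 7^2`, `2^3 ≤ 11`, `2^4 ≤ 17`, `2^5 ≤ 37` from below). [folklore] -/
theorem sum_lt_log_of_le {N : ℕ} (h2 : 2 ≤ N) (h40 : N ≤ 40) :
    ∑ p ∈ primesLE N, Real.log p / p < Real.log N := by
  have hL0 : 0 < Real.log 2 := by linarith [Real.log_two_gt_d9]
  -- upper bounds `d log p ≤ c log 2`
  have u3 : (5 : ℝ) * log 3 ≤ 8 * log 2 := by exact_mod_cast pow_log_le 3 5 2 8
  have u5 : (3 : ℝ) * log 5 ≤ 7 * log 2 := by exact_mod_cast pow_log_le 5 3 2 7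
  have u7 : (1 : ℝ) * log 7 ≤ 3 * log 2 := by exact_mod_cast pow_log_le 7 1 2 3
  have u11 : (2 : ℝ) * log 11 ≤ 7 * log 2 := by exact_mod_cast pow_log_le 11 2 2 7
  have u13 : (1 : ℝ) * log 13 ≤ 4 * log 2 := by exact_mod_cast pow_log_le 13 1 2 4
  have u17 : (2 : ℝ) * log 17 ≤ 9 * log 2 := by exact_mod_cast pow_log_le 17 2 2 9
  have u19 : (2 : ℝ) * log 19 ≤ 9 * log 2 := by exact_mod_cast pow_log_le 19 2 2 9
  have u23 : (1 : ℝ) * log 23 ≤ 5 * log 2 := by exact_mod_cast pow_log_le 23 1 2 5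
  have u29 : (1 : ℝ) * log 29 ≤ 5 * log 2 := by exact_mod_cast pow_log_le 29 1 2 5
  have u31 : (1 : ℝ) * log 31 ≤ 5 * log 2 := by exact_mod_cast pow_log_le 31 1 2 5
  have u37 : (1 : ℝ) * log 37 ≤ 6 * log 2 := by exact_mod_cast pow_log_le 37 1 2 6
  -- lower bounds `c log 2 ≤ d log q`
  have l3 : (3 : ℝ) * log 2 ≤ 2 * log 3 := by exact_mod_cast pow_log_le 2 3 3 2
  have l5 : (2 : ℝ) * log 2 ≤ 1 * log 5 := by exact_mod_cast pow_log_le 2 2 5 1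
  have l7 : (5 : ℝ) * log 2 ≤ 2 * log 7 := by exact_mod_cast pow_log_le 2 5 7 2
  have l11 : (3 : ℝ) * log 2 ≤ 1 * log 11 := by exact_mod_cast pow_log_le 2 3 11 1
  have l13 : (3 : ℝ) * log 2 ≤ 1 * log 13 := by exact_mod_cast pow_log_le 2 3 13 1
  have l17 : (4 : ℝ) * log 2 ≤ 1 * log 17 := by exact_mod_cast pow_log_le 2 4 17 1
  have l19 : (4 : ℝ) * log 2 ≤ 1 * log 19 := by exact_mod_cast pow_log_le 2 4 19 1
  have l23 : (4 : ℝ) * log 2 ≤ 1 * log 23 := by exact_mod_cast pow_log_le 2 4 23 1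
  have l29 : (4 : ℝ) * log 2 ≤ 1 * log 29 := by exact_mod_cast pow_log_le 2 4 29 1
  have l31 : (4 : ℝ) * log 2 ≤ 1 * log 31 := by exact_mod_cast pow_log_le 2 4 31 1
  have l37 : (5 : ℝ) * log 2 ≤ 1 * log 37 := by exact_mod_cast pow_log_le 2 5 37 1
  -- `log q ≤ log N` for `0 < q ≤ N`
  have hq : ∀ q : ℕ, 0 < q → q ≤ N → Real.log q ≤ Real.log N := fun q hq0 hqN =>
    Real.log_le_log (by exact_mod_cast hq0) (by exact_mod_cast hqN)
  -- the twelve intervals `[q, q')`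
  rcases (by omega : N ≤ 2 ∨ (3 ≤ N ∧ N ≤ 4) ∨ (5 ≤ N ∧ N ≤ 6) ∨ (7 ≤ N ∧ N ≤ 10) ∨
      (11 ≤ N ∧ N ≤ 12) ∨ (13 ≤ N ∧ N ≤ 16) ∨ (17 ≤ N ∧ N ≤ 18) ∨ (19 ≤ N ∧ N ≤ 22) ∨
      (23 ≤ N ∧ N ≤ 28) ∨ (29 ≤ N ∧ N ≤ 30) ∨ (31 ≤ N ∧ N ≤ 36) ∨ (37 ≤ N ∧ N ≤ 40)) with
    hb | ⟨ha, hb⟩ | ⟨ha, hb⟩ | ⟨ha, hb⟩ | ⟨ha, hb⟩ | ⟨ha, hb⟩ | ⟨ha, hb⟩ | ⟨ha, hb⟩ | ⟨ha, hb⟩ |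
    ⟨ha, hb⟩ | ⟨ha, hb⟩ | ⟨ha, hb⟩
  · have hle := sum_le_of_subset hb (by decide : primesLE 2 ⊆ {2})
    rw [sum_singleton] at hle; push_cast at hle
    have hqN : Real.log (2 : ℝ) ≤ Real.log N := by exact_mod_cast hq 2 (by norm_num) h2
    linarith
  · have hle := sum_le_of_subset hb (by decide : primesLE 4 ⊆ {2, 3})
    (repeat rw [sum_insert (by decide)] at hle); rw [sum_singleton] at hle; push_cast at hle
    have hqN : Real.log (3 : ℝ) ≤ Real.log N := by exact_mod_cast hq 3 (by norm_num) ha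
    linarith
  · have hle := sum_le_of_subset hb (by decide : primesLE 6 ⊆ {2, 3, 5})
    (repeat rw [sum_insert (by decide)] at hle); rw [sum_singleton] at hle; push_cast at hle
    have hqN : Real.log (5 : ℝ) ≤ Real.log N := by exact_mod_cast hq 5 (by norm_num) ha
    linarith
  · have hle := sum_le_of_subset hb (by decide : primesLE 10 ⊆ {2, 3, 5, 7})
    (repeat rw [sum_insert (by decide)] at hle); rw [sum_singleton] at hle; push_cast at hle
    have hqN : Real.log (7 : ℝ) ≤ Real.log N := by exact_mod_cast hq 7 (by norm_num) ha
    linarith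
  · have hle := sum_le_of_subset hb (by decide : primesLE 12 ⊆ {2, 3, 5, 7, 11})
    (repeat rw [sum_insert (by decide)] at hle); rw [sum_singleton] at hle; push_cast at hle
    have hqN : Real.log (11 : ℝ) ≤ Real.log N := by exact_mod_cast hq 11 (by norm_num) ha
    linarith
  · have hle := sum_le_of_subset hb (by decide : primesLE 16 ⊆ {2, 3, 5, 7, 11, 13})
    (repeat rw [sum_insert (by decide)] at hle); rw [sum_singleton] at hle; push_cast at hle
    have hqN : Real.log (13 : ℝ) ≤ Real.log N := by exact_mod_cast hq 13 (by norm_num) ha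
    linarith
  · have hle := sum_le_of_subset hb (by decide : primesLE 18 ⊆ {2, 3, 5, 7, 11, 13, 17})
    (repeat rw [sum_insert (by decide)] at hle); rw [sum_singleton] at hle; push_cast at hle
    have hqN : Real.log (17 : ℝ) ≤ Real.log N := by exact_mod_cast hq 17 (by norm_num) ha
    linarith
  · have hle := sum_le_of_subset hb (by decide : primesLE 22 ⊆ {2, 3, 5, 7, 11, 13, 17, 19})
    (repeat rw [sum_insert (by decide)] at hle); rw [sum_singleton] at hle; push_cast at hle
    have hqN : Real.log (19 : ℝ) ≤ Real.log N := by exact_mod_cast hq 19 (by norm_num) ha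
    linarith
  · have hle := sum_le_of_subset hb
      (by decide : primesLE 28 ⊆ {2, 3, 5, 7, 11, 13, 17, 19, 23})
    (repeat rw [sum_insert (by decide)] at hle); rw [sum_singleton] at hle; push_cast at hle
    have hqN : Real.log (23 : ℝ) ≤ Real.log N := by exact_mod_cast hq 23 (by norm_num) ha
    linarith
  · have hle := sum_le_of_subset hb
      (by decide : primesLE 30 ⊆ {2, 3, 5, 7, 11, 13, 17, 19, 23, 29})
    (repeat rw [sum_insert (by decide)] at hle); rw [sum_singleton] at hle; push_cast at hle
    have hqN : Real.log (29 : ℝ) ≤ Real.log N := by exact_mod_cast hq 29 (by norm_num) ha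
    linarith
  · have hle := sum_le_of_subset hb
      (by decide : primesLE 36 ⊆ {2, 3, 5, 7, 11, 13, 17, 19, 23, 29, 31})
    (repeat rw [sum_insert (by decide)] at hle); rw [sum_singleton] at hle; push_cast at hle
    have hqN : Real.log (31 : ℝ) ≤ Real.log N := by exact_mod_cast hq 31 (by norm_num) ha
    linarith
  · have hle := sum_le_of_subset hb
      (by decide : primesLE 40 ⊆ {2, 3, 5, 7, 11, 13, 17, 19, 23, 29, 31, 37})
    (repeat rw [sum_insert (by decide)] at hle); rw [sum_singleton] at hle; push_cast at hle
    have hqN : Real.log (37 : ℝ) ≤ Real.log N := by exact_mod_cast hq 37 (by norm_num) ha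
    linarith

/-- For every natural `N ≥ 2`, `Σ_{p ≤ N} (log p)/p < log N`.
[cite: RosserSchoenfeld1962, Thm. 6 Cor. (3.24)] -/
theorem sum_lt_log (N : ℕ) (hN : 2 ≤ N) :
    ∑ p ∈ primesLE N, Real.log p / p < Real.log N := by
  rcases le_or_gt N 40 with h | h
  · exact sum_lt_log_of_le hN h
  · exact sum_lt_log_of_ge N (by omega)

end RosserSchoenfeld324

/-- **Rosser–Schoenfeld 1962, Corollary to Theorem 6, (3.24)** (discharge of the named fact
`RosserSchoenfeld1962_eq_3_24`): for real `x > 1`, `Σ_{p ≤ x} (log p)/p < log x`. Proved here by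
the elementary Chebyshev–Legendre–Stirling argument of this file for `⌊x⌋ ≥ 41` and twelve
explicit checks below that (`RosserSchoenfeld324.sum_lt_log`), not by the authors' `θ`-tables.
[cite: RosserSchoenfeld1962, Thm. 6 Cor. (3.24), p. 70] -/
theorem RosserSchoenfeld1962_eq_3_24_holds : RosserSchoenfeld1962_eq_3_24 := by
  intro x hx
  have hx0 : 0 ≤ x := by linarith
  have hN1 : 1 ≤ ⌊x⌋₊ := Nat.le_floor (by exact_mod_cast hx.le)
  rcases eq_or_lt_of_le hN1 with h1 | h2
  · rw [← h1, Nat.primesLE_one, Finset.sum_empty]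
    exact Real.log_pos hx
  · calc ∑ p ∈ Nat.primesLE ⌊x⌋₊, Real.log p / p < Real.log (⌊x⌋₊ : ℕ) :=
          RosserSchoenfeld324.sum_lt_log _ h2
      _ ≤ Real.log x :=
          Real.log_le_log (by exact_mod_cast (by omega : 0 < ⌊x⌋₊)) (Nat.floor_le hx0)

end Literature.NumberTheory.LFunctions
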